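import Mathlib
import HarnessLib
import Summits.HubbardSuperconductivity.HubbardSuperconductivity.Theorems.KLProgrammeKLRegimeSplitGlueP4
import Summits.HubbardSuperconductivity.HubbardSuperconductivity.Theorems.KLProgrammeKLRegimeVolumeLimitExDefs
import Summits.HubbardSuperconductivity.HubbardSuperconductivity.Theorems.KLProgrammeKLRegimeSplitSlotsV17F2

/-!
# Route `KLProgramme` — crux K3 `KLRegimeTwoPointLimit` (stmt-HubbardSuperconductivity-19937): the GEN-8 (7-flow, cure 1) CHILDREN TEXTS and the GLUE at `klPredsV17F2`
# (plan g16 K3-FLOW RULING F, KL STATUS 2026-08-27 l.2548, step S2 re-keyed on S1 rev 2 = `…SplitSlotsV17F2` (p527694, cure 1 of k3c2-p2's (E2-F) ball finding);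
# seat hubbard-kl-k3c3-p2; the V17F twin is `…ChildrenV17F` p527166)

The five children of the re-split onto the flowing-dispersion bundle `klPredsV17F2` (`…SplitSlotsV17F2` ⊇ `…SplitSlotsV17F`: dummy frame `K = 0`, flow frame `klFlowFrameU … n`
read inside every slot) and the K3-named glue, in the shape the pen's `--resplit …` verb (rev 22, items 20437–20442) and gen 6's precedent
(`…SplitGlueV16P4Ex` / glue item 20241) expect:
* the children TEXTS are the generics BY NAME (no new definitions; kernel lane): child 3-F `KLRegimeEngineV17F2 := EngineP4 klPredsV17F2 klWindowC`,
  child 1-F `KLRegimeBetaSplitV17F2 := BetaSplitP klPredsV17F2 klWindowC`, child 2-F `KLRegimeRenormFlowV17F2 := CountertermP2 klPredsV17F2 klWindowC` (the FORWARD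
  induction: renorm-history ⇒ engine ∧ twoLeg ∧ split at `n` ⇒ `RenormFlowAtV17F` at every `n ≤ n_β`, dummy `K := 0`; proved in `…RenormFlowV17F2`),
  child 5-F `KLRegimeVolumeLimitV17F2 := VolumeLimitP2 klPredsV17F2 FinalTwoLegVolLimitEx klWindowC`, child 4-F `KLRegimeTwoPointAssemblyV17F2 :=
  TwoPointAssemblyP3 klPredsV17F2 FinalTwoLegVolLimitEx klWindowC` — in this ORDER in the glue's binders (Engine, BetaSplit, RenormFlow, VolumeLimit, TwoPointAssembly);
* **`KLRegimeTwoPointLimit_of_V17F2`**: the five texts imply `…Theses.KLProgramme.KLRegimeTwoPointLimit` BY NAME — `KLRegimeInductionP4 klPredsV17F2 FinalTwoLegVolLimitEx`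
  VERBATIM (the generic machinery hosts the flow scheme without edit, PF-0);
* AT-BIRTH closers that need no engine: **`twoPointAssemblyP3_klPredsV17F2`** (child 4-F; `twoPointAssemblyP3_ex` is `Pr`-universal — K3-FLOW-PRICING Q-F2 (i)),
  `klPredsV17F2_frameOK_zeroC` ((R6-3): the bare frame is the dummy class's point, `klFrameOK_zeroC`).
Nothing here asserts superconductivity; no engine stub is proved here.
-/

noncomputable section

namespace Summit.HubbardSuperconductivity.HubbardSuperconductivity.Theorems.KLRegimeSplit

set_option linter.dupNamespace false -- summit = problem name (single-conjunct summit), D-0017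

/-- **THE K3-NAMED GLUE AT `klPredsV17F2`** (`KLRegimeInductionP4` VERBATIM): the five gen-8 (7-flow, cure 1) children imply crux K3 `KLRegimeTwoPointLimit` BY NAME. -/
theorem KLRegimeTwoPointLimit_of_V17F2 :
    EngineP4 klPredsV17F2 klWindowC → BetaSplitP klPredsV17F2 klWindowC → CountertermP2 klPredsV17F2 klWindowC →
      VolumeLimitP2 klPredsV17F2 FinalTwoLegVolLimitEx klWindowC → TwoPointAssemblyP3 klPredsV17F2 FinalTwoLegVolLimitEx klWindowC →
        Summit.HubbardSuperconductivity.HubbardSuperconductivity.Theses.KLProgramme.KLRegimeTwoPointLimit :=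
  KLRegimeInductionP4 klPredsV17F2 FinalTwoLegVolLimitEx

/-- **Child 4-F closes AT BIRTH**: `TwoPointAssemblyP3 klPredsV17F2 FinalTwoLegVolLimitEx klWindowC` — `twoPointAssemblyP3_ex` is `Pr`-universal (reads only the
volume-limit slot). -/
theorem twoPointAssemblyP3_klPredsV17F2 : TwoPointAssemblyP3 klPredsV17F2 FinalTwoLegVolLimitEx klWindowC :=
  twoPointAssemblyP3_ex klPredsV17F2 klWindowC

/-- **(R6-3) at V17F2**: the bare frame is (the only point of) the dummy frame class, on the covariance window (`klFrameOK_zeroC`). -/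
theorem klPredsV17F2_frameOK_zeroC {R : RenConsts} (hR : R.WF) (U : ℝ) (N : ℕ) {μ : ℝ} (hμ : μ ∈ klWindowC) : klPredsV17F2.frameOK R U N μ 0 :=
  ⟨rfl, klFrameOK_zeroC hR U N hμ⟩

end Summit.HubbardSuperconductivity.HubbardSuperconductivity.Theorems.KLRegimeSplit

end
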